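import Mathlib
import Literature.Computability.AlgebraicComplexity.StandardFamilies
import Literature.Computability.AlgebraicComplexity.HessianAtOrigin
import Literature.Computability.AlgebraicComplexity.MignonRessayreBound
import Literature.RingTheory.Nullstellensatz.SkodaBrownawellDegreeBound
import Summits.ValiantsHypothesis.ValiantsHypothesis.Theses.RefutationDegree
import Summits.ValiantsHypothesis.ValiantsHypothesis.Theorems.RefutationDegreeDefs
import Summits.ValiantsHypothesis.ValiantsHypothesis.Theorems.RefutationDegreeRefutationBarrierConverse
import Summits.ValiantsHypothesis.ValiantsHypothesis.Theorems.RefutationDegreeRefutationBarrierFanoByOne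
import Summits.ValiantsHypothesis.ValiantsHypothesis.Theorems.RefutationDegreeBeyondHessianSosPlusTwo

/-!
# Crux `BeyondHessianNs` (stmt-ValiantsHypothesis-5641) HOLDS modulo the Skoda–Brownawell degree bound

Theorem file of crux item stmt-ValiantsHypothesis-5641 (`RefutationDegree.BeyondHessianNs`, line `Sketch`,
lead c2): the crux — for all large `n`, the coefficient system `Rep(n, ⌊n²/2⌋+1)` ("`per_n` is the
determinant of an affine pencil of size `⌊n²/2⌋+1`") has a Nullstellensatz refutation with every product of
degree `≤ n^c` — is PROVED CONDITIONALLY on the named analytic fact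
`Literature.RingTheory.Nullstellensatz.skodaBrownawellDegreeBound` (Skoda 1972 Théorème 1 / Brownawell 1987:
a Łojasiewicz inequality at infinity with exponent `E` for generators of degree `D` in `N` variables gives a
Bezout identity of degree `(N+1)(E+D)`), with `c = 9` and `n₀ = 55`:

* `not_inBorder_sq_div_two_add_one` — **`per_n` is OFF the affine border at the quadratic size**: for
  `n ≥ 55`, `per_n` is NOT a coefficientwise limit of determinants of affine pencils of size `⌊n²/2⌋+1`
  (`¬ InBorder n (⌊n²/2⌋+1)`).  UNCONDITIONAL.  Proof: the border-robust kernel plane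
  (`…RefutationBarrierFanoByOne.sq_le_add_of_inBorder`: `InBorder n m` and "every linear per-null subspace
  through the zero `y` has dimension `≤ d`" give `n² ≤ m + d`) at the Mignon–Ressayre point `y₀`, where the
  sibling crux's flat bound `…BeyondHessianSosPlusTwo.nine_mul_finrank_flat_le` (border slicing + Kneser's
  theorem for Hadamard products) gives `d = (4(n-1)² + 36(n-1) - 9)/9`; and `9 ⌈n²/2⌉ > 4n² + 28n - 32` for
  `n ≥ 55`.  (Equivalently: the affine border determinantal complexity of `per_n` is `≥ ⌊n²/2⌋ + 2` for
  `n ≥ 55` — one resp. two more than Landsberg–Manivel–Ressayre's `n²/2` in this affine-border model.)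
* `hasNsRef_sq_div_two_add_one_of_skodaBrownawell` — modulo Skoda–Brownawell, `Rep(n, ⌊n²/2⌋+1)` has a
  Nullstellensatz refutation of degree `≤ n⁹` for every `n ≥ 55`: off the border the squared coefficient
  distance `Σ_μ |P_μ(a)|²` is bounded below by some `ε > 0` on all of unknown-space (Łojasiewicz exponent `0`,
  `…RefutationBarrierConverse.lojZero_of_not_inBorder`), so Skoda–Brownawell applies with `E = 0`, `D = m`,
  `N = (n²+1)m²` (`…RefutationBarrierConverse.hasNsRef_of_not_inBorder`), degree `(n²+1)m³ + m ≤ n⁹`.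
* `BeyondHessianNs_of_skodaBrownawell` — the crux BY NAME, from the named fact.

So the positive horn of the route's dichotomy holds and its negation `RefutationBarrier` (crux #3) fails, both
modulo Skoda–Brownawell; the certificates are non-constructive (L² methods).  The line `Sketch`'s algebraic
programme (jet calibration: a polynomial `Ψ` of degree `n^c` vanishing on the jet variety and not at the
permanent's jet, `stub_polyDegreeSeparation`) would give EXPLICIT certificates and remains open; its existence
half `stub_jetSeparationMr` is landed (`…BeyondHessianNsJetSeparation.lean`).
-/

noncomputable section

-- single-conjunct layout: Sub = Summit, duplicated namespace component intended
set_option linter.dupNamespace false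

namespace Summit.ValiantsHypothesis.ValiantsHypothesis.Theorems.RefutationDegreeBeyondHessianNs

open MvPolynomial
open Literature.Computability.AlgebraicComplexity
open Literature.RingTheory.Nullstellensatz (skodaBrownawellDegreeBound)
open Summit.ValiantsHypothesis.ValiantsHypothesis.Theorems.RefutationDegree
open Summit.ValiantsHypothesis.ValiantsHypothesis.Theorems.RefutationDegreeBeyondHessianSos
  (nine_mul_finrank_flat_le)

/-- **`per_n` is off the affine border at the quadratic size** (unconditional): for `n ≥ 55`, `per_n` is
not a coefficientwise limit of determinants of size-`(⌊n²/2⌋+1)` affine pencils.  (Border-robust kernel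
plane `sq_le_add_of_inBorder` at the Mignon–Ressayre zero `y₀`, whose linear per-null subspaces have
`9 dim + 9 ≤ 4(n-1)² + 36(n-1)` by `nine_mul_finrank_flat_le`; arithmetic `9⌈n²/2⌉ > 4n² + 28n - 32`.) -/
theorem not_inBorder_sq_div_two_add_one {n : ℕ} (hn : 55 ≤ n) : ¬ InBorder n (n ^ 2 / 2 + 1) := by
  intro hB
  obtain ⟨p, rfl⟩ : ∃ p, n = p + 3 := ⟨n - 3, by omega⟩
  have hb := sq_le_add_of_inBorder (d := (4 * (p + 2) ^ 2 + 36 * (p + 2) - 9) / 9) hB (mrPoint ℂ p)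
    eval_mrPoint_perPoly fun W hyW hW => by
      have h9 := nine_mul_finrank_flat_le p (by omega) W hyW hW
      omega
  -- `(p+3)² ≤ (p+3)²/2 + 1 + (4(p+2)² + 36(p+2) - 9)/9` is false for `p ≥ 52`
  obtain ⟨q, rfl⟩ : ∃ q, p = q + 52 := ⟨p - 52, by omega⟩
  have ha : (q + 52 + 3) ^ 2 = (q + 52 + 2) ^ 2 + 2 * (q + 52 + 2) + 1 := by ring
  have hb2 : 54 * (q + 52 + 2) ≤ (q + 52 + 2) ^ 2 := by nlinarith
  set a := (q + 52 + 3) ^ 2 with hadef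
  set b := (q + 52 + 2) ^ 2 with hbdef
  omega

/-- Monotonicity of the route's Nullstellensatz predicate in the degree. [folklore] -/
theorem hasNsRef_mono {n m D D' : ℕ} (hle : D ≤ D') (h : HasNsRef n m D) : HasNsRef n m D' := by
  obtain ⟨g, hdeg, hsum⟩ := h
  exact ⟨g, fun μ => (hdeg μ).trans hle, hsum⟩

/-- **Degree-`n⁹` Nullstellensatz refutations at the quadratic size, modulo Skoda–Brownawell**: for
`n ≥ 55`, `Rep(n, ⌊n²/2⌋+1)` has a Nullstellensatz refutation with every product of degree `≤ n⁹`
(`hasNsRef_of_not_inBorder`: off the border, Łojasiewicz exponent `0`, degree `(n²+1)m³ + m`;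
`sb_budget_le_pow_nine`). -/
theorem hasNsRef_sq_div_two_add_one_of_skodaBrownawell {n : ℕ}
    (hSB : skodaBrownawellDegreeBound (σ := Unk n (n ^ 2 / 2 + 1)) (ι := (Fin n × Fin n) →₀ ℕ))
    (hn : 55 ≤ n) : HasNsRef n (n ^ 2 / 2 + 1) (n ^ 9) :=
  hasNsRef_mono (sb_budget_le_pow_nine (by omega))
    (hasNsRef_of_not_inBorder hSB (not_inBorder_sq_div_two_add_one hn))

/-- **The crux `RefutationDegree.BeyondHessianNs` holds modulo the Skoda–Brownawell degree bound**: with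
`c = 9` and `n₀ = 55`, for every `n ≥ n₀` the coefficient system of
`det(A₀ + Σ_e x_e A_e) = per_n(x)` at size `⌊n²/2⌋ + 1` has a Nullstellensatz refutation `Σ_μ h_μ P_μ = 1`
with every product of total degree `≤ n ^ c` (the crux's matrix is literally `HasNsRef n (⌊n²/2⌋+1) (n^c)`).
CONDITIONAL on the named fact `skodaBrownawellDegreeBound` (Skoda 1972 / Brownawell 1987). -/
theorem BeyondHessianNs_of_skodaBrownawell
    (hSB : ∀ n m : ℕ, skodaBrownawellDegreeBound (σ := Unk n m) (ι := (Fin n × Fin n) →₀ ℕ)) :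
    Summit.ValiantsHypothesis.ValiantsHypothesis.Theses.RefutationDegree.BeyondHessianNs := by
  refine ⟨9, 55, fun n hn => ?_⟩
  exact hasNsRef_sq_div_two_add_one_of_skodaBrownawell (hSB n _) hn

end Summit.ValiantsHypothesis.ValiantsHypothesis.Theorems.RefutationDegreeBeyondHessianNs

end
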